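import Summits.BirchSwinnertonDyer.Rank1Residual.X11b.BDPRouteSurj
import Summits.BirchSwinnertonDyer.Rank1Residual.AdditivePotMult.RankOneHeegnerAnyPrime
import HarnessLib

/-!
# Class X11b, route "BDP + converse-theorem engine + Kolyvagin": the `¬`(ram) atom — Euler-system half from X11a's lower half, `BSD(E,p)` from STEP L + X11a's lower half (cell `b2b-bsdres`, sub-cell `multr1-p2`, gen 6)

HONEST FRAMING (cell `b2b-bsdres`, run/shared/lean/b2b/bsd-rank1-residual/, verbatim in every
file): the goal of the cell is to DELETE the COMBINATION-SHAPED residual classes of the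
Birch–Swinnerton-Dyer formula for ALL analytic-rank `≤ 1` elliptic curves over `ℚ` — "full BSD
formula for every rank `≤ 1` curve in class `C`" assembled STRICTLY from published theorems — so
that the rank-`≤ 1` remainder becomes exactly the CONSTRUCTION-SHAPED classes, which are TYPED
(missing-input `Prop`s), NOT attempted. This is not "finishing BSD". Sub-cell `multr1-p2` is a
RESEARCH ROUTE on class X11b (`ClassX11b W p := r_an = 1 ∧ p ≠ 2 ∧ mult(p) ∧ irr(p)`,
`Partition/Rows.lean`); no claim beyond the stated class and loci; X11b's label does not change;
nothing is booked.

THEOREMS ONLY (no definition, no named fact). The `¬`(ram) atom of X11b at `p ≥ 5` (`¬ Ram W p`: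
no multiplicative `q ≠ p` with `E[p]` ramified at `q`; hyp SUBCELL-LEDGER atoms `X11b:noram.*`,
11 ‖ 2 CORE-open pairs at `N < 2·10⁴ ‖ 10⁴`, all with `ρ̄_{E,p}` onto). Companion of
`X11b/BDPRouteSurj.lean` (the main-conjecture half there ⇐ STEP L for every surjective X11b pair).
Here the Euler-system half: Kolyvagin 1990 Thm. A over a Friedberg–Hoffstein Heegner field `K`
(`ρ̄` onto suffices) bounds `#Ш(E/K)` by the Heegner index; Gross–Zagier bookkeeping turns this into
`ord_p #Ш(E) ≤ ord_p #Ш(E)_an + 2·ord_p ∏c_ℓ(E)` PROVIDED the main-conjecture half of the rank-`0`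
`p`-part holds for the twist `E^{d_K}` — additive-p1's class-agnostic tool
`AdditivePotMult.padicValNat_shaOrder_le_add_of_rankOne_of_lowerTwists_of_not_sq_dvd`
(Jetchev–Skinner–Wan 2017 §7.4.2 architecture; Manin-unit datum from `p² ∤ N`). For an X11b ∧
`¬`(ram) pair the twist `E^{d_K}` (minimal model `Wd`) is an **X11a pair**
(`ClassX11a Wd p := r_an = 0 ∧ p ≠ 2 ∧ mult ∧ irr ∧ ¬ram`; transports (a) mult, (b) irr of
`TwistTransport*.lean` and (c) reversed, `not_ram_twist_of_heegner`). So: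

* `classX11a_twist_of_not_ram` — the Heegner twists of an X11b ∧ `¬`(ram) pair are X11a pairs;
* **`padicValNat_shaOrder_le_add_of_classX11b_of_not_ram_of_lowerX11a`** — X11b ∧ `p ≥ 5` ∧
  `¬`(ram) ∧ surj: (main-conjecture half on class X11a at `p`) ⇒ Kolyvagin's Tamagawa-defect bound;
  `missingUpperBoundAt_of_classX11b_of_not_ram_of_lowerX11a` (`p ∤ ∏c_ℓ`: the Euler-system half);
* **`bsdp_of_classX11b_of_not_ram_of_lower_of_lowerX11a`** /
  **`bsdp_of_classX11b_of_not_ram_of_indexLowerBoundAt_of_lowerX11a`** — on X11b ∧ `¬`(ram) ∧ surj ∧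
  `p ≥ 5` ∧ `p ∤ ∏c_ℓ`: `BSD(E,p)` ⇐ the pair's own lower half (⇐ STEP L, `BDPRouteSurj`) + X11a's
  lower half at `p`; every other input a PUBLISHED named fact (Gross–Zagier, Kolyvagin ×2, Wuthrich
  2014 Prop. 21, GZK, modularity ×2, Friedberg–Hoffstein, Mazur 1978 Cor. 4.1, Néron mapping property).

READING: x11a's sub-class "`r = 0 ∧ ¬`(ram)" (X11a) is reached by NO published or announced theorem
(Skinner–Urban / Skinner 2016 need (ram)); this file records what the `¬`(ram) atom of X11b hinges on
(STEP L for its lower half, X11a's lower half for its upper half) — bookkeeping, not a closure. With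
gens 3–5 the route's map of X11b at `p ≥ 5` is complete: (ram) ∧ `p ∤ ∏c`: `BSD(E,p)` ⟺ lower half
⟺ STEP L (`BDPRouteRigidityClass`); (ram) ∧ `p ∣ ∏c`: lower ⇐ STEP L, upper ≤ `+ 2·ord_p ∏c`
(`BDPRouteTamagawaDefect`); `¬`(ram) ∧ surj: lower ⇐ STEP L (`BDPRouteSurj`), upper ⇐ X11a's lower
half (here). CONDITIONAL; nothing booked; X11b and X11a stay CONSTRUCTION-SHAPED.

References: [McCallumLMS1991] §1; [JetchevSkinnerWan2017] §7.4.2 (p. 31 of arXiv:1512.06894);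
[Wuthrich2014] Prop. 21 (p. 400); [SilvermanAEC2009] X.5 Cor. 5.4, VII.5 Prop. 5.1; [Mazur1978]
Cor. 4.1; [Miller2011LMS] Def. 1.1.
-/

noncomputable section

open scoped Classical

open WeierstrassCurve NumberField Literature.NumberTheory.EllipticCurves
  Literature.NumberTheory.EllipticCurves.ModularForms
  Literature.NumberTheory.EllipticCurves.Rank1Residual
  Literature.NumberTheory.EllipticCurves.Rank1Residual.Typed
  Literature.NumberTheory.EllipticCurves.Wuthrich2014

namespace Summit.BirchSwinnertonDyer.Rank1Residual.X11b

/-! ### §3 The `¬`(ram) atom: the Euler-system half from X11a's lower half; `BSD(E,p)` from lower halves -/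

/-- **The Heegner twists of an X11b ∧ `¬`(ram) pair are X11a pairs.** For `W` globally minimal in
X11b at `p` with `¬ Ram W p`, `K` imaginary quadratic with every `ℓ ∣ N` split, and `Wd = Cd •
W^{(d_K)}` globally minimal of analytic rank `0`: `ClassX11a Wd p` (`r_an = 0`, `p ≠ 2`,
multiplicative at `p` — transport (a) —, `E^D[p]` irreducible — transport (b) —, `¬ Ram Wd p` —
transport (c) reversed, `not_ram_twist_of_heegner`). [cite: SilvermanAEC2009, X.5 Cor. 5.4 and VII.5 Prop. 5.1(b)] -/
theorem classX11a_twist_of_not_ram (W : WeierstrassCurve ℚ) [W.IsElliptic] [W.IsGloballyMinimal]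
    (p : ℕ) [Fact p.Prime] (hX : ClassX11b W p) (hnram : ¬ Ram W p)
    (K : Type) [Field K] [NumberField K] (hK : IsImaginaryQuadratic K)
    (hHN : SatisfiesHeegnerHypothesis (W.conductorNorm ℤ) K)
    {Wd : WeierstrassCurve ℚ} [Wd.IsElliptic] [Wd.IsGloballyMinimal] (Cd : VariableChange ℚ)
    (hWd : Cd • W.quadraticTwist (NumberField.discr K : ℚ) = Wd) (hrd : Wd.analyticRank = 0) :
    ClassX11a Wd p := by
  obtain ⟨-, hp2, hmult, hirr⟩ := hX
  exact ⟨hrd, hp2, hasMultiplicativeReductionAtPrime_twist_of_heegner' W p K hK hHN hmult Cd hWd,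
    hasIrreducibleModPGaloisRep_twist_model W p K hK.1 hirr Cd hWd,
    not_ram_twist_of_heegner W p K hK hHN hnram Cd hWd⟩

/-- **Kolyvagin's Tamagawa defect on the `¬`(ram) atom of X11b, relative to X11a's lower half.**
For `(E,p)` in X11b with `p ≥ 5`, `¬ Ram W p` and `ρ̄_{E,p}` onto: IF the main-conjecture half
`Typed.MissingLowerBoundAt Wd p` holds at every globally minimal `Wd` with `ClassX11a Wd p` (the
rank-`0` sister class at the same `p`), THEN `#Ш(E)_an = q ∈ ℚ` with
`ord_p #Ш(E) ≤ ord_p q + 2·ord_p ∏_ℓ c_ℓ(E)`. Proof: additive-p1's class-agnostic tool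
`AdditivePotMult.padicValNat_shaOrder_le_add_of_rankOne_of_lowerTwists_of_not_sq_dvd` (Kolyvagin
1990 Thm. A over a Friedberg–Hoffstein field + Gross–Zagier bookkeeping + the Manin-unit datum at
`p² ∤ N`), whose hypothesis "lower half of every rank-`0` Heegner twist in which `p` splits" is met
because those twists are X11a pairs (`classX11a_twist_of_not_ram`). PUBLISHED binders `hGZ`, `hKo`,
`hB`, `hGZK`, `hmod`, `hnf`, `hFH`, `hMaz`, `hNS`; the X11a half `hX11a` is OPEN (x11a: no published
or announced theorem reaches `r = 0 ∧ ¬ram`). CONDITIONAL; nothing booked.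
[cite: McCallumLMS1991, §1 Theorem (Kolyvagin), p. 296] [cite: JetchevSkinnerWan2017, §7.4.2 (p. 31)]
[cite: Mazur1978, Cor. 4.1] [cite: Miller2011LMS, Def. 1.1] -/
theorem padicValNat_shaOrder_le_add_of_classX11b_of_not_ram_of_lowerX11a
    (hGZ : ∀ (N : ℕ) [NeZero N] (W : WeierstrassCurve ℚ) (K : Type) [Field K] [NumberField K],
      gross_zagier N W K)
    (hKo : ∀ (N : ℕ) [NeZero N] (W : WeierstrassCurve ℚ) (K : Type) [Field K] [NumberField K],
      kolyvagin N W K)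
    (hB : ∀ (N : ℕ) [NeZero N] (W : WeierstrassCurve ℚ) (K : Type) [Field K] [NumberField K],
      Kolyvagin1990_padicValNat_card_sha_le N W K)
    (hGZK : rank_eq_analyticRank_of_analyticRank_le_one) (hmod : hasEntireLFunction_rat)
    (hnf : exists_isNewformOf) (hFH : friedbergHoffstein_exists_heegnerField_split_twist_ne_zero)
    (hMaz : mazur_not_dvd_maninConstant_of_odd) (hNS : integral_neronScaling_of_isGloballyMinimal)
    (W : WeierstrassCurve ℚ) [W.IsElliptic] [W.IsGloballyMinimal] (p : ℕ) [Fact p.Prime]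
    (hX : ClassX11b W p) (hp5 : 5 ≤ p) (hnram : ¬ Ram W p) (hsurj : Surj W p)
    (hX11a : ∀ (Wd : WeierstrassCurve ℚ) [Wd.IsElliptic] [Wd.IsGloballyMinimal],
      ClassX11a Wd p → Typed.MissingLowerBoundAt Wd p) :
    ∃ q : ℚ, shaAn W = (q : ℂ) ∧
      (padicValNat p W.shaOrder : ℤ) ≤ padicValRat p q + 2 * padicValNat p W.tamagawaProduct := by
  haveI : NeZero (W.conductorNorm ℤ) := ⟨(W.conductorNorm_pos_holds).ne'⟩
  have hpN : ¬ p ^ 2 ∣ W.conductorNorm ℤ := not_sq_dvd_conductorNorm_of_mult W p hX.2.2.1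
  exact AdditivePotMult.padicValNat_shaOrder_le_add_of_rankOne_of_lowerTwists_of_not_sq_dvd hGZ hKo
    hB hGZK hmod hnf hFH hMaz hNS W p hX.2.2.2 hsurj hp5 hX.1 hpN
    (fun K _ _ Wd _ _ hK hHN _ ⟨C, hC⟩ hrd ↦
      hX11a Wd (classX11a_twist_of_not_ram W p hX hnram K hK hHN C hC hrd))

/-- **The Euler-system half on X11b ∧ `¬`(ram) ∧ surj ∧ `p ≥ 5` ∧ `p ∤ ∏ c_ℓ`, relative to X11a's
lower half** (same hypotheses): `Typed.MissingUpperBoundAt W p`. CONDITIONAL on `hX11a`.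
[cite: McCallumLMS1991, §1 Theorem (Kolyvagin), p. 296] [cite: Miller2011LMS, Def. 1.1] -/
theorem missingUpperBoundAt_of_classX11b_of_not_ram_of_lowerX11a
    (hGZ : ∀ (N : ℕ) [NeZero N] (W : WeierstrassCurve ℚ) (K : Type) [Field K] [NumberField K],
      gross_zagier N W K)
    (hKo : ∀ (N : ℕ) [NeZero N] (W : WeierstrassCurve ℚ) (K : Type) [Field K] [NumberField K],
      kolyvagin N W K)
    (hB : ∀ (N : ℕ) [NeZero N] (W : WeierstrassCurve ℚ) (K : Type) [Field K] [NumberField K],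
      Kolyvagin1990_padicValNat_card_sha_le N W K)
    (hGZK : rank_eq_analyticRank_of_analyticRank_le_one) (hmod : hasEntireLFunction_rat)
    (hnf : exists_isNewformOf) (hFH : friedbergHoffstein_exists_heegnerField_split_twist_ne_zero)
    (hMaz : mazur_not_dvd_maninConstant_of_odd) (hNS : integral_neronScaling_of_isGloballyMinimal)
    (W : WeierstrassCurve ℚ) [W.IsElliptic] [W.IsGloballyMinimal] (p : ℕ) [Fact p.Prime]
    (hX : ClassX11b W p) (hp5 : 5 ≤ p) (hnram : ¬ Ram W p) (hsurj : Surj W p)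
    (htam : ¬ p ∣ W.tamagawaProduct)
    (hX11a : ∀ (Wd : WeierstrassCurve ℚ) [Wd.IsElliptic] [Wd.IsGloballyMinimal],
      ClassX11a Wd p → Typed.MissingLowerBoundAt Wd p) :
    Typed.MissingUpperBoundAt W p := by
  obtain ⟨q, hq, hle⟩ := padicValNat_shaOrder_le_add_of_classX11b_of_not_ram_of_lowerX11a hGZ hKo
    hB hGZK hmod hnf hFH hMaz hNS W p hX hp5 hnram hsurj hX11a
  refine ⟨q, hq, ?_⟩
  rw [padicValNat.eq_zero_of_not_dvd htam, Nat.cast_zero, mul_zero, add_zero] at hle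
  exact hle

/-- **`BSD(E,p)` on the `¬`(ram) atom of X11b from LOWER halves only.** For `(E,p)` in X11b with
`p ≥ 5`, `¬ Ram W p`, `ρ̄_{E,p}` onto and `p ∤ ∏_ℓ c_ℓ(E)`: the pair's own main-conjecture half
`Typed.MissingLowerBoundAt W p` (⇐ STEP L: `missingLowerBoundAt_of_classX11b_of_surj`) and the
main-conjecture half on class X11a at `p` (`hX11a`) imply Miller's `BSD(E,p)` — the Euler-system
half is `missingUpperBoundAt_of_classX11b_of_not_ram_of_lowerX11a` (Kolyvagin). CONDITIONAL on the
two OPEN lower halves; PUBLISHED binders otherwise. Nothing booked; X11b stays CONSTRUCTION-SHAPED.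
[cite: McCallumLMS1991, §1 Theorem (Kolyvagin), p. 296] [cite: Miller2011LMS, Def. 1.1] -/
theorem bsdp_of_classX11b_of_not_ram_of_lower_of_lowerX11a
    (hGZ : ∀ (N : ℕ) [NeZero N] (W : WeierstrassCurve ℚ) (K : Type) [Field K] [NumberField K],
      gross_zagier N W K)
    (hKo : ∀ (N : ℕ) [NeZero N] (W : WeierstrassCurve ℚ) (K : Type) [Field K] [NumberField K],
      kolyvagin N W K)
    (hB : ∀ (N : ℕ) [NeZero N] (W : WeierstrassCurve ℚ) (K : Type) [Field K] [NumberField K],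
      Kolyvagin1990_padicValNat_card_sha_le N W K)
    (hGZK : rank_eq_analyticRank_of_analyticRank_le_one) (hmod : hasEntireLFunction_rat)
    (hnf : exists_isNewformOf) (hFH : friedbergHoffstein_exists_heegnerField_split_twist_ne_zero)
    (hMaz : mazur_not_dvd_maninConstant_of_odd) (hNS : integral_neronScaling_of_isGloballyMinimal)
    (W : WeierstrassCurve ℚ) [W.IsElliptic] [W.IsGloballyMinimal] (p : ℕ) [Fact p.Prime]
    (hX : ClassX11b W p) (hp5 : 5 ≤ p) (hnram : ¬ Ram W p) (hsurj : Surj W p)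
    (htam : ¬ p ∣ W.tamagawaProduct) (hlow : Typed.MissingLowerBoundAt W p)
    (hX11a : ∀ (Wd : WeierstrassCurve ℚ) [Wd.IsElliptic] [Wd.IsGloballyMinimal],
      ClassX11a Wd p → Typed.MissingLowerBoundAt Wd p) :
    BSDp W p :=
  Typed.bsdp_of_missingPPartAt W p hGZK (by rw [hX.1])
    (Typed.missingPPartAt_of_lower_of_upper W p hlow
      (missingUpperBoundAt_of_classX11b_of_not_ram_of_lowerX11a hGZ hKo hB hGZK hmod hnf hFH hMaz
        hNS W p hX hp5 hnram hsurj htam hX11a))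

/-- **The `¬`(ram) atom, end form: `BSD(E,p)` ⇐ STEP L + X11a's lower half.** For every `(E,p)` in
X11b with `p ≥ 5`, `¬ Ram W p`, `ρ̄_{E,p}` onto and `p ∤ ∏_ℓ c_ℓ(E)`: STEP L at the Manin-good
Heegner data of the surjective X11b pairs (`hL`, the route's typed input, OPEN at `p ∥ N`) and the
main-conjecture half on class X11a at `p` (`hX11a`, OPEN) give `BSD(E,p)`, all other inputs being
PUBLISHED named facts (Gross–Zagier, Kolyvagin ×2, Wuthrich 2014 Prop. 21, GZK, modularity ×2,
Friedberg–Hoffstein, Mazur 1978 Cor. 4.1, Néron mapping property). With gens 3–5 this completes the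
route's map of X11b at `p ≥ 5`: (ram) ∧ `p ∤ ∏c`: `BSD(E,p)` ⟺ lower half ⟺ STEP L
(`BDPRouteRigidityClass`); (ram) ∧ `p ∣ ∏c`: lower ⇐ STEP L, upper ≤ `+ 2·ord_p ∏c`
(`BDPRouteTamagawaDefect`); `¬`(ram) ∧ surj: lower ⇐ STEP L (this file, §2), upper ⇐ X11a's lower
half (§3). CONDITIONAL; nothing booked; labels unchanged. [cite: Wuthrich2014, Prop. 21 (p. 400)]
[cite: McCallumLMS1991, §1 Theorem (Kolyvagin), p. 296] [cite: Miller2011LMS, Def. 1.1] -/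
theorem bsdp_of_classX11b_of_not_ram_of_indexLowerBoundAt_of_lowerX11a
    (hGZ : ∀ (N : ℕ) [NeZero N] (W : WeierstrassCurve ℚ) (K : Type) [Field K] [NumberField K],
      gross_zagier N W K)
    (hKo : ∀ (N : ℕ) [NeZero N] (W : WeierstrassCurve ℚ) (K : Type) [Field K] [NumberField K],
      kolyvagin N W K)
    (hB : ∀ (N : ℕ) [NeZero N] (W : WeierstrassCurve ℚ) (K : Type) [Field K] [NumberField K],
      Kolyvagin1990_padicValNat_card_sha_le N W K)
    (hWu : sha_dvd_analyticSha)
    (hGZK : rank_eq_analyticRank_of_analyticRank_le_one) (hmod : hasEntireLFunction_rat)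
    (hnf : exists_isNewformOf) (hFH : friedbergHoffstein_exists_heegnerField_split_twist_ne_zero)
    (hMaz : mazur_not_dvd_maninConstant_of_odd) (hNS : integral_neronScaling_of_isGloballyMinimal)
    -- the typed input of the route (STEP L), at every Heegner datum with Manin constant prime to `p`
    (hL : ∀ (W : WeierstrassCurve ℚ) [W.IsElliptic] [W.IsGloballyMinimal] (p : ℕ) [Fact p.Prime]
      (N : ℕ) [NeZero N] (K : Type) [Field K] [NumberField K]
      (Dt : ModularParametrizationData W N) (H : HeegnerDatum N (NumberField.discr K)) (ι : K →+* ℂ)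
      (P : (W.baseChange K).toAffine.Point),
      ClassX11b W p → 5 ≤ p → Surj W p → W.conductorNorm ℤ = N → IsImaginaryQuadratic K →
      SatisfiesHeegnerHypothesis N K →
      WeierstrassCurve.Affine.Point.map ι.toRatAlgHom P = heegnerPointComplex Dt H →
      ¬ (p : ℤ) ∣ Dt.c → IndexLowerBoundAt W p K P)
    -- the main-conjecture half on the rank-0 sister class X11a
    (hX11a : ∀ (Wd : WeierstrassCurve ℚ) [Wd.IsElliptic] [Wd.IsGloballyMinimal] (p : ℕ)
      [Fact p.Prime], ClassX11a Wd p → Typed.MissingLowerBoundAt Wd p) :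
    ∀ (W : WeierstrassCurve ℚ) [W.IsElliptic] [W.IsGloballyMinimal] (p : ℕ) [Fact p.Prime],
      ClassX11b W p → 5 ≤ p → ¬ Ram W p → Surj W p → ¬ p ∣ W.tamagawaProduct → BSDp W p := by
  intro W _ _ p _ hX hp5 hnram hsurj htam
  exact bsdp_of_classX11b_of_not_ram_of_lower_of_lowerX11a hGZ hKo hB hGZK hmod hnf hFH hMaz hNS W
    p hX hp5 hnram hsurj htam
    (missingLowerBoundAt_of_classX11b_of_surj hGZ hKo hWu hGZK hmod hnf hFH hMaz hNS hL W p hX hp5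
      hsurj)
    (fun Wd _ _ hXa ↦ hX11a Wd p hXa)

end Summit.BirchSwinnertonDyer.Rank1Residual.X11b

end
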